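import Summits.HodgeConjecture.CorCM.CyclotomicRankTableTwentyEight
import HarnessLib

/-!
# Kubota-rank census of the degree-`12` cyclotomic CM fields `ℚ(ζ₂₁) = ℚ(ζ₄₂)`, `ℚ(ζ₂₈)`, `ℚ(ζ₃₆)`:
# exactly half of the primitive CM types are nondegenerate; the Hodge conjecture for all powers of their simple
# CM sixfolds, and exceptional `(3,3)`-classes on the realisations of the other half

COR-CM (cell `pub-hodgecm2`), binder seat b04 (gen 11), count-neutral claim CYCLO-RANK-CENSUS; consumer of the DATA
files `CorCM/CyclotomicRankTable{TwentyOne,TwentyEight,ThirtySix}` (tables `certs{m}` / `pairs{m}` / `degs{m}` and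
their kernel checks `census{m}`, `certs{m}_all`, `degs{m}_all`) and of `CorCM/CyclotomicRankCertificates`.  THIS
FILE: §0 the generic keyed-row consumers and the level `28`; levels `21`, `36` in the sequel
`CorCM/CyclotomicRankCensusDegreeTwelveB.lean`.  KERNEL ONLY: theorems (plus one kernel count per level); no named
fact, no `sorry`.  (The fourth degree-`12`
cyclotomic field, `ℚ(ζ₁₃)`, has ALL `60` primitive types nondegenerate: `CorCM/CyclotomicRankCensusThirteen`.)

For `m ∈ {21, 28, 36}` (`Gal(ℚ(ζ_m)/ℚ) ≅ C₂ × C₆`, two imaginary quadratic subfields) the `64` CM types of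
`L ≅ ℚ(ζ_m)` split `16 + 24 + 24`:
* `16` IMPRIMITIVE (no simple realisation);
* `24` primitive and NONDEGENERATE (Kubota rank `7`): for these, `Bᵐ(Aⁿ) ⊗ ℂ = Dᵐ(Aⁿ) ⊗ ℂ` and **the Hodge
  conjecture for every power of every realisation, UNCONDITIONALLY** (`hodgeConjectureFor_pow_of_mem_certs_{m}`);
* `24` primitive and DEGENERATE, of rank EXACTLY `6` (`cmTypeRank_eq_six_of_mem_degs_{m}`), each balanced with
  multiplicities `(3,3)` over an imaginary quadratic subfield (the balanced set `P` of the table is an index-`2`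
  subgroup of `(ℤ/m)ˣ` avoiding `-1`): every realisation is a SIMPLE CM abelian sixfold carrying a rational
  `(3,3)`-class OUTSIDE `D³ ⊗ ℂ` (`exists_exceptional_of_mem_degs_{m}`, Pohlmann's criterion) — `24 + 24 + 24`
  new instances of the phenomenon the tree recorded for ONE type (`Pohlmann1968.Cyclotomic.Φ₂₁`,
  `DegenerateCMTypeCyclotomic21`): abelian CM fields of degree `12` with primitive degenerate types (Dodson:
  `B(6) < 7`).  For these `72` types the Hodge conjecture is the algebraicity of Weil-type `(3,3)` classes; at
  levels `36` and `42 = 21` ALL types are Fermat, so it holds MODULO Aoki's theorem on powers of `J(F_m)`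
  (A7 lane, `CorCM/CyclotomicSliceAllTypesThirtySix/FortyTwo`); at `28` (Aoki degree `2²·7`) the `24` degenerate
  primitive types are all translates of Fermat types of full level `28` (seat script `scratch/fermat28.py`),
  while the Fermat census misses one class of NONDEGENERATE types — now covered here unconditionally.
* `trichotomy_{m}`: every CM type of `L` is nondegenerate, imprimitive, or one of the `24` keyed degenerate types;
  `cmTypeRank_eq_seven_or_six_of_isPrimitive_{m}`: a primitive type has rank `7` or `6` (Dodson's `5 ≤ rank` is never
  attained here; cf. the cell's `CMSixfoldRank/RankAtLeastSix`, seat lit-deligne-3, which proves `rank ≥ 6` for every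
  primitive type on `12` embeddings — not used).

## References

* [Dodson1987] B. Dodson, J. Algebra 111 (1987), §1.1, Thm. 1.0, Remark 1.1, Cor. 1.5.
* [Gordon1999HodgeAVSurvey] B. B. Gordon, *A survey of the Hodge conjecture for abelian varieties*, Thm. 6.4, 9.2.2,
  §9.3–9.4, 9.4.3 (Yanai).
* [Pohlmann1968] H. Pohlmann, Ann. of Math. 88 (1968), Thm. 1, §3.
* [Shimura1998] G. Shimura, *Abelian Varieties with Complex Multiplication and Modular Functions*, §6.2 Thm. 3,
  §8.2 Prop. 26.
-/

noncomputable section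

open CategoryTheory CategoryTheory.Limits NumberField

namespace Summit.HodgeConjecture.CorCM.CyclotomicRank

open Literature.NumberTheory.ComplexMultiplication
open Literature.AlgebraicGeometry.Motives (AbelianVariety CMType)
open Literature.AlgebraicGeometry.HodgeTheory
open Literature.AlgebraicGeometry.ComplexMultiplication (IsCMTypeRealisation)
open Literature.AlgebraicGeometry.VanGeemen1994 (hodgeClassSpan)
open Literature.Barriers.HodgeConjecture (divisorClassesSpan)
open Literature.AlgebraicGeometry.Pohlmann1968
open Literature.AlgebraicGeometry.Pohlmann1968.Cyclotomic

/-! ### §0 Keyed rows (generic level `N`) -/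

section Rows

variable {N : ℕ} [NeZero N] {L : Type} [Field L] [NumberField L] [IsCyclotomicExtension {N} ℚ L]
variable {U : List (ZMod N)} {r r' : ℕ}

omit [NeZero N] in
/-- A row whose key reads a CM type gives the CM condition of `cmTypeOfResidues`. [folklore] -/
theorem cm_of_isCMTypeB (hU : ∀ c : ZMod N, c.val.Coprime N ↔ c ∈ U) {l : List (ZMod N)}
    (h : isCMTypeB U l = true) : ∀ c : ZMod N, c.val.Coprime N → (c ∈ l.toFinset ↔ -c ∉ l.toFinset) := by
  intro c hc
  rw [isCMTypeB, List.all_eq_true] at h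
  have h1 := h c ((hU c).1 hc)
  rw [decide_eq_true_iff] at h1
  rwa [List.mem_toFinset, List.mem_toFinset]

/-- **A keyed minor certificate of full size gives a nondegenerate type.** [cite: Dodson1987, §1.1 (p. 51)] -/
theorem isNondegenerate_of_certRow (hN : 2 < N) (hr : N.totient / 2 + 1 = r)
    {e : List (ZMod N) × (Fin r → ZMod N) × (Fin r → ZMod N) × (Fin r → Fin r → ℤ) × ℤ}
    (he : minorCert e.1 e.2.1 e.2.2.1 e.2.2.2.1 e.2.2.2.2 = true)
    (hS : ∀ c : ZMod N, c.val.Coprime N → (c ∈ e.1.toFinset ↔ -c ∉ e.1.toFinset)) :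
    IsNondegenerate (cmTypeOfResidues (L := L) e.1.toFinset hS) :=
  isNondegenerate_of_minorCert hN (fun _ => List.mem_toFinset.symm) hr he

omit [NeZero N] in
/-- **What a keyed degenerate row says at the `Prop` level**: separating translates, a balanced non-symmetric residue
set, and a valid smaller minor certificate. [cite: Gordon1999HodgeAVSurvey, §9.2 (9.2.1) and §9.4] -/
theorem of_degRow {d : List (ZMod N) × Finset (ZMod N) × (Fin r' → ZMod N) × (Fin r' → ZMod N) ×
      (Fin r' → Fin r' → ℤ) × ℤ}
    (hd : (isCMTypeB U d.1 && sepB U d.1 && balancedB U d.1 d.2.1 &&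
      minorCert d.1 d.2.2.1 d.2.2.2.1 d.2.2.2.2.1 d.2.2.2.2.2) = true) :
    isCMTypeB U d.1 = true ∧
    (∀ a ∈ U.toFinset, ∀ b ∈ U.toFinset,
        (∀ u ∈ U.toFinset, (u * a ∈ d.1.toFinset ↔ u * b ∈ d.1.toFinset)) → a = b) ∧
    (d.2.1 ⊆ U.toFinset ∧ (∀ u ∈ U.toFinset, 2 * (d.2.1.filter fun c => u * c ∈ d.1.toFinset).card = d.2.1.card) ∧
      ∃ c ∈ d.2.1, -c ∉ d.2.1) ∧
    minorCert d.1 d.2.2.1 d.2.2.2.1 d.2.2.2.2.1 d.2.2.2.2.2 = true := by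
  classical
  simp only [Bool.and_eq_true] at hd
  obtain ⟨⟨⟨hcm, hsep⟩, hbal⟩, hcert⟩ := hd
  have hmem : ∀ x, x ∈ d.1.toFinset ↔ x ∈ d.1 := fun x => List.mem_toFinset
  have hpat : ∀ a b : ZMod N, (U.all fun u => decide (u * a ∈ d.1 ↔ u * b ∈ d.1)) = true ↔
      ∀ u ∈ U.toFinset, (u * a ∈ d.1.toFinset ↔ u * b ∈ d.1.toFinset) := fun a b => by
    rw [List.all_eq_true]
    exact ⟨fun h u hu => by have := h u (List.mem_toFinset.1 hu); rwa [decide_eq_true_iff, ← hmem, ← hmem] at this,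
      fun h u hu => by rw [decide_eq_true_iff, ← hmem, ← hmem]; exact h u (List.mem_toFinset.2 hu)⟩
  refine ⟨hcm, ?_, ?_, hcert⟩
  · intro a ha b hb hab
    rw [sepB, List.all_eq_true] at hsep
    have h1 := List.all_eq_true.1 (hsep a (List.mem_toFinset.1 ha)) b (List.mem_toFinset.1 hb)
    rw [Bool.or_eq_true, decide_eq_true_iff, Bool.not_eq_true', ← Bool.not_eq_true] at h1
    rcases h1 with h1 | h1
    · exact h1
    · exact absurd ((hpat a b).2 hab) h1
  · simp only [balancedB, Bool.and_eq_true, decide_eq_true_iff, List.all_eq_true, beq_iff_eq] at hbal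
    obtain ⟨⟨hP, hb⟩, hns⟩ := hbal
    refine ⟨hP, fun u hu => ?_, hns⟩
    rw [← hb u (List.mem_toFinset.1 hu)]
    congr 2
    ext c
    simp only [Finset.mem_filter, hmem]

/-- **A keyed degenerate row gives a primitive, degenerate type of rank exactly `r' = n`** (given `r' + 1 =
φ(N)/2 + 1`). [cite: Gordon1999HodgeAVSurvey, §9.4] [cite: Kubota1965, §2 (p. 115)] -/
theorem degenerate_of_degRow (hN : 2 < N) (hU : ∀ c : ZMod N, c.val.Coprime N ↔ c ∈ U) (hr : N.totient / 2 = r')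
    {d : List (ZMod N) × Finset (ZMod N) × (Fin r' → ZMod N) × (Fin r' → ZMod N) ×
      (Fin r' → Fin r' → ℤ) × ℤ}
    (hd : (isCMTypeB U d.1 && sepB U d.1 && balancedB U d.1 d.2.1 &&
      minorCert d.1 d.2.2.1 d.2.2.2.1 d.2.2.2.2.1 d.2.2.2.2.2) = true)
    (hS : ∀ c : ZMod N, c.val.Coprime N → (c ∈ d.1.toFinset ↔ -c ∉ d.1.toFinset)) (φ₀ : L →+* ℂ) :
    IsPrimitive (ℂ ≃+* ℂ) (cmTypeOfResidues (L := L) d.1.toFinset hS).1 φ₀ ∧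
      ¬IsNondegenerate (cmTypeOfResidues (L := L) d.1.toFinset hS) ∧
      cmTypeRank (cmTypeOfResidues (L := L) d.1.toFinset hS) = r' := by
  haveI := isCMField_of_two_lt (L := L) hN
  have hU' : ∀ c : ZMod N, c.val.Coprime N ↔ c ∈ U.toFinset := fun c => by rw [List.mem_toFinset]; exact hU c
  obtain ⟨-, hsep, ⟨hP, hbal, hns⟩, hcert⟩ := of_degRow hd
  have hnd := not_isNondegenerate_of_residues (L := L) (hS := hS) U.toFinset hU' hN hP hbal hns
  refine ⟨isPrimitive_of_residues U.toFinset hU' hsep φ₀, hnd, ?_⟩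
  have hge := le_cmTypeRank_of_minorCert (L := L) (hS := hS) (fun _ => List.mem_toFinset.symm) hcert
  have hle := cmTypeRank_le (cmTypeOfResidues (L := L) d.1.toFinset hS)
  rw [isNondegenerate_iff] at hnd
  rw [finrank_eq_totient N L, hr] at hle hnd
  omega

variable {A : AbelianVariety ℂ} {ι : 𝓞 L →+* End A} {θ : L →+* Module.End ℂ (complexBetti A.X 1)}

/-- **A keyed degenerate row with `|P| = 2k`: every realisation is SIMPLE and carries a rational `(k,k)`-class outside
`Dᵏ ⊗ ℂ`** (Pohlmann's criterion for primitive types). [cite: Gordon1999HodgeAVSurvey, 9.2.2 and §9.4]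
[cite: Pohlmann1968, Thm. 1 and §3] [cite: Shimura1998, §8.2 Prop. 26] -/
theorem exceptional_of_degRow (hN : 2 < N) (hU : ∀ c : ZMod N, c.val.Coprime N ↔ c ∈ U)
    {d : List (ZMod N) × Finset (ZMod N) × (Fin r' → ZMod N) × (Fin r' → ZMod N) ×
      (Fin r' → Fin r' → ℤ) × ℤ}
    (hd : (isCMTypeB U d.1 && sepB U d.1 && balancedB U d.1 d.2.1 &&
      minorCert d.1 d.2.2.1 d.2.2.2.1 d.2.2.2.2.1 d.2.2.2.2.2) = true)
    {k : ℕ} (hk : d.2.1.card = 2 * k)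
    {hS : ∀ c : ZMod N, c.val.Coprime N → (c ∈ d.1.toFinset ↔ -c ∉ d.1.toFinset)}
    (hA : IsCMTypeRealisation (cmTypeOfResidues (L := L) d.1.toFinset hS) A ι θ) :
    A.IsSimple ∧ ∃ c : complexBetti A.X (2 * k), IsRationalClass c ∧
      IsOfHodgeType (Module.finrank ℚ L / 2) A.X (2 * k) k k c ∧
      c ∉ divisorClassesSpan A.X (Module.finrank ℚ L / 2) k := by
  have hU' : ∀ c : ZMod N, c.val.Coprime N ↔ c ∈ U.toFinset := fun c => by rw [List.mem_toFinset]; exact hU c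
  obtain ⟨-, hsep, ⟨hP, hbal, hns⟩, -⟩ := of_degRow hd
  exact ⟨isSimple_of_residues U.toFinset hU' hsep hA,
    exists_exceptional_of_residues U.toFinset hU' hN hsep hP hbal hns hk hA⟩

/-- Extracting a row property from a table-wide kernel check. [folklore] -/
theorem row_of_all {α : Type} {l : List α} {p : α → Bool} (h : l.all p = true) {x : α} (hx : x ∈ l) :
    p x = true :=
  List.all_eq_true.1 h x hx

end Rows

/-! ### Level `28`: `ℚ(ζ₂₈)` -/

section TwentyEight

/-- The balanced sets of the `24` degenerate rows at level `28` have `6 = 2·3` elements (multiplicities `(3,3)` over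
`ℚ(i)` or `ℚ(√-7)`). [cite: Gordon1999HodgeAVSurvey, 9.4.3] -/
theorem degs28_card : (degs28.all fun d => d.2.1.card == 2 * 3) = true := by decide +kernel

variable (L : Type) [Field L] [NumberField L] [IsCyclotomicExtension {28} ℚ L]

/-- **Trichotomy at level `28`**: every CM type of `ℚ(ζ₂₈)` is nondegenerate, or imprimitive, or one of the `24`
keyed degenerate primitive types (rank `≥ 6`, not `7`). [cite: Dodson1987, §1.1 and Thm. 1.0]
[cite: Gordon1999HodgeAVSurvey, §9.4] -/
theorem trichotomy_twentyEight (Φ : CMType L) (φ₀ : L →+* ℂ) :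
    IsNondegenerate Φ ∨ ¬IsPrimitive (ℂ ≃+* ℂ) Φ.1 φ₀ ∨
      ∃ d ∈ degs28, ∃ hK : (∀ c : ZMod 28, c.val.Coprime 28 → (c ∈ d.1.toFinset ↔ -c ∉ d.1.toFinset)),
        Φ = cmTypeOfResidues (L := L) d.1.toFinset hK ∧ IsPrimitive (ℂ ≃+* ℂ) Φ.1 φ₀ ∧ ¬IsNondegenerate Φ ∧
          6 ≤ cmTypeRank Φ :=
  trichotomy_of_census (by norm_num) coprime_iff_mem_U28 totient_twentyEight census28 Φ φ₀

/-- **A primitive CM type of `ℚ(ζ₂₈)` has Kubota rank `7` or `6`.** [cite: Dodson1987, Thm. 1.0 and Remark 1.1] -/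
theorem cmTypeRank_eq_seven_or_six_of_isPrimitive_twentyEight (Φ : CMType L) (φ₀ : L →+* ℂ)
    (hprim : IsPrimitive (ℂ ≃+* ℂ) Φ.1 φ₀) : cmTypeRank Φ = 7 ∨ cmTypeRank Φ = 6 := by
  haveI := isCMField_of_two_lt (L := L) (N := 28) (by norm_num)
  have h7 : Nat.totient 28 / 2 + 1 = 7 := totient_twentyEight
  rcases trichotomy_twentyEight L Φ φ₀ with h | h | ⟨d, -, hK, -, -, hnd, h6⟩
  · left; rw [isNondegenerate_iff, finrank_eq_totient 28 L, h7] at h; exact h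
  · exact absurd hprim h
  · right
    have hle := cmTypeRank_le Φ
    rw [isNondegenerate_iff] at hnd
    rw [finrank_eq_totient 28 L, h7] at hle hnd
    omega

/-- **The `24` keyed nondegenerate types of `ℚ(ζ₂₈)` are nondegenerate** (rank `7`). [cite: Dodson1987, §1.1] -/
theorem isNondegenerate_of_mem_certs_twentyEight {e : List (ZMod 28) × (Fin 7 → ZMod 28) × (Fin 7 → ZMod 28) ×
      (Fin 7 → Fin 7 → ℤ) × ℤ} (he : e ∈ certs28)
    (hS : ∀ c : ZMod 28, c.val.Coprime 28 → (c ∈ e.1.toFinset ↔ -c ∉ e.1.toFinset)) :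
    IsNondegenerate (cmTypeOfResidues (L := L) e.1.toFinset hS) := by
  have h := row_of_all certs28_all he
  rw [Bool.and_eq_true] at h
  exact isNondegenerate_of_certRow (by norm_num) totient_twentyEight h.2 hS

/-- Every key of `certs28` reads a CM type (the hypothesis `hS` above is available). [folklore] -/
theorem cm_of_mem_certs_twentyEight {e : List (ZMod 28) × (Fin 7 → ZMod 28) × (Fin 7 → ZMod 28) ×
      (Fin 7 → Fin 7 → ℤ) × ℤ} (he : e ∈ certs28) :
    ∀ c : ZMod 28, c.val.Coprime 28 → (c ∈ e.1.toFinset ↔ -c ∉ e.1.toFinset) := by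
  have h := row_of_all certs28_all he
  rw [Bool.and_eq_true] at h
  exact cm_of_isCMTypeB coprime_iff_mem_U28 h.1

/-- Every key of `degs28` reads a CM type. [folklore] -/
theorem cm_of_mem_degs_twentyEight {d : List (ZMod 28) × Finset (ZMod 28) × (Fin 6 → ZMod 28) × (Fin 6 → ZMod 28) ×
      (Fin 6 → Fin 6 → ℤ) × ℤ} (hd : d ∈ degs28) :
    ∀ c : ZMod 28, c.val.Coprime 28 → (c ∈ d.1.toFinset ↔ -c ∉ d.1.toFinset) :=
  cm_of_isCMTypeB coprime_iff_mem_U28 (of_degRow (row_of_all degs28_all hd)).1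

variable {L} {A : AbelianVariety ℂ} {ι : 𝓞 L →+* End A} {θ : L →+* Module.End ℂ (complexBetti A.X 1)}

/-- **`Bᵐ(Aⁿ) ⊗ ℂ = Dᵐ(Aⁿ) ⊗ ℂ` on every power of every realisation of the `24` keyed nondegenerate types of `ℚ(ζ₂₈)`.**
[cite: Gordon1999HodgeAVSurvey, Thm. 6.4 and §9.3] -/
theorem hodgeClassSpan_pow_eq_divisorClassesSpan_of_mem_certs_twentyEight {e : List (ZMod 28) × (Fin 7 → ZMod 28) ×
      (Fin 7 → ZMod 28) × (Fin 7 → Fin 7 → ℤ) × ℤ} (he : e ∈ certs28)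
    {hS : ∀ c : ZMod 28, c.val.Coprime 28 → (c ∈ e.1.toFinset ↔ -c ∉ e.1.toFinset)}
    (hA : IsCMTypeRealisation (cmTypeOfResidues (L := L) e.1.toFinset hS) A ι θ) (n k : ℕ) :
    hodgeClassSpan (⨁ fun _ : Fin n => A).dim (⨁ fun _ : Fin n => A).X k =
      divisorClassesSpan (⨁ fun _ : Fin n => A).X (⨁ fun _ : Fin n => A).dim k := by
  haveI := isCMField_of_two_lt (L := L) (N := 28) (by norm_num)
  exact (isNondegenerate_of_mem_certs_twentyEight L he hS).hodgeClassSpan_pow_eq_divisorClassesSpan hA n k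

/-- **The Hodge conjecture for every power of every realisation of the `24` keyed nondegenerate CM types of
`ℚ(ζ₂₈)`** (simple CM abelian sixfolds) — UNCONDITIONAL. [cite: Gordon1999HodgeAVSurvey, Thm. 6.4 and §9.3]
[cite: Deligne2000, §1] -/
theorem hodgeConjectureFor_pow_of_mem_certs_twentyEight {e : List (ZMod 28) × (Fin 7 → ZMod 28) × (Fin 7 → ZMod 28) ×
      (Fin 7 → Fin 7 → ℤ) × ℤ} (he : e ∈ certs28)
    {hS : ∀ c : ZMod 28, c.val.Coprime 28 → (c ∈ e.1.toFinset ↔ -c ∉ e.1.toFinset)}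
    (hA : IsCMTypeRealisation (cmTypeOfResidues (L := L) e.1.toFinset hS) A ι θ) (n : ℕ) :
    HodgeConjectureFor (⨁ fun _ : Fin n => A).dim (⨁ fun _ : Fin n => A).X := by
  haveI := isCMField_of_two_lt (L := L) (N := 28) (by norm_num)
  exact (isNondegenerate_of_mem_certs_twentyEight L he hS).hodgeConjectureFor_pow hA n

/-- **The `24` keyed degenerate types of `ℚ(ζ₂₈)` are primitive, degenerate, of Kubota rank exactly `6`.**
[cite: Gordon1999HodgeAVSurvey, §9.4 and 9.4.3] [cite: Dodson1987, Remark 1.1] -/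
theorem degenerate_of_mem_degs_twentyEight {d : List (ZMod 28) × Finset (ZMod 28) × (Fin 6 → ZMod 28) ×
      (Fin 6 → ZMod 28) × (Fin 6 → Fin 6 → ℤ) × ℤ} (hd : d ∈ degs28)
    (hS : ∀ c : ZMod 28, c.val.Coprime 28 → (c ∈ d.1.toFinset ↔ -c ∉ d.1.toFinset)) (φ₀ : L →+* ℂ) :
    IsPrimitive (ℂ ≃+* ℂ) (cmTypeOfResidues (L := L) d.1.toFinset hS).1 φ₀ ∧
      ¬IsNondegenerate (cmTypeOfResidues (L := L) d.1.toFinset hS) ∧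
      cmTypeRank (cmTypeOfResidues (L := L) d.1.toFinset hS) = 6 :=
  degenerate_of_degRow (by norm_num) coprime_iff_mem_U28 (by decide) (row_of_all degs28_all hd) hS φ₀

/-- **Every realisation of each of the `24` keyed degenerate types of `ℚ(ζ₂₈)` is a SIMPLE abelian sixfold with a
rational `(3,3)`-class outside `D³ ⊗ ℂ`** (Weil classes over `ℚ(i)` or `ℚ(√-7)`). [cite: Gordon1999HodgeAVSurvey, 9.2.2 and 9.4.3]
[cite: Pohlmann1968, Thm. 1 and §3] -/
theorem exists_exceptional_of_mem_degs_twentyEight {d : List (ZMod 28) × Finset (ZMod 28) × (Fin 6 → ZMod 28) ×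
      (Fin 6 → ZMod 28) × (Fin 6 → Fin 6 → ℤ) × ℤ} (hd : d ∈ degs28)
    {hS : ∀ c : ZMod 28, c.val.Coprime 28 → (c ∈ d.1.toFinset ↔ -c ∉ d.1.toFinset)}
    (hA : IsCMTypeRealisation (cmTypeOfResidues (L := L) d.1.toFinset hS) A ι θ) :
    A.IsSimple ∧ A.dim = 6 ∧ ∃ c : complexBetti A.X (2 * 3), IsRationalClass c ∧
      IsOfHodgeType 6 A.X (2 * 3) 3 3 c ∧ c ∉ divisorClassesSpan A.X 6 3 := by
  have hk : d.2.1.card = 2 * 3 := by simpa using row_of_all degs28_card hd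
  have h := exceptional_of_degRow (L := L) (by norm_num) coprime_iff_mem_U28 (row_of_all degs28_all hd) hk hA
  have h6 : Module.finrank ℚ L / 2 = 6 := by rw [finrank_eq_totient 28 L]; decide
  rw [h6] at h
  exact ⟨h.1, (dim_eq_of_realisation (N := 28) hA).trans (by decide), h.2⟩

end TwentyEight

end Summit.HodgeConjecture.CorCM.CyclotomicRank

end
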